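import Literature.Probability.RandomPlanarGeometry.SAWCountMonotoneEscapeOdd
import Literature.Probability.RandomPlanarGeometry.SAWCountMonotoneTen
import HarnessLib

/-!
# Monotonicity `cₙ ≤ cₙ₊₁` (O'Brien 1990): the proven RANGE collected — `cₘ ≤ cₙ` along every initial
# segment `m ≤ n ≤ 6d - 1` (and `n ≤ 11`), and at the even lengths `n ≤ 8d - 6`

Bookkeeping file.  The tree proves O'Brien's one-step inequality `cₙ ≤ cₙ₊₁` on `ℤ^d` in the ranges
`n + 2 ≤ 6d` (`SAWCountMonotoneEscapeOdd.lean`, every `d ≥ 1`), `n` even with `n + 6 ≤ 8d`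
(`SAWCountMonotoneEscapeEven.lean`) and `n ≤ 10` (`SAWCountMonotoneTen.lean`, every `d ≥ 1`).  Here the
one-step statements are merged and chained into the MONOTONICITY OF `n ↦ cₙ` ON AN INITIAL SEGMENT, the
form in which the inequality is used (e.g. for `cₘ ≤ cₙ`, `m ≤ n`, in ratio and submultiplicativity
arguments):

* `count_le_count_succ_of_range` : `cₙ ≤ cₙ₊₁` whenever `n + 2 ≤ 6d` or `n ≤ 10` or (`n` even and `n + 6 ≤ 8d`);
* `count_mono_of_le` : **`cₘ ≤ cₙ` for all `m ≤ n` with `n + 1 ≤ max (6d, 12)`** (`d ≥ 1`);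
* `monotoneOn_count` : `MonotoneOn (count d) {n | n + 1 ≤ max (6 * d) 12}`.

The general statement (all `n`) is O'Brien's theorem, the tree's named fact `BDGS2012_count_mono`.

[cite: BDGS2012, §1.3 (`cₙ ≤ cₙ₊₁`, O'Brien 1990)] [cite: MadrasSlade1993, §7.1 p. 231]
-/

noncomputable section

open Literature.Probability.LatticeModels Literature.Probability.Percolation SimpleGraph

namespace Literature.Probability.RandomPlanarGeometry.SAW.Zd

variable {d : ℕ}

/-- **`cₙ ≤ cₙ₊₁` on the proven range**: `n + 2 ≤ 6d`, or `n ≤ 10`, or `n` even with `n + 6 ≤ 8d`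
(`d ≥ 1`). [cite: BDGS2012, §1.3] -/
theorem count_le_count_succ_of_range {n : ℕ} (hd : 1 ≤ d)
    (h : n + 2 ≤ 6 * d ∨ n ≤ 10 ∨ (Even n ∧ n + 6 ≤ 8 * d)) : count d n ≤ count d (n + 1) := by
  rcases h with h | h | ⟨hev, h⟩
  · exact count_le_count_succ_of_le_six_mul_sub_two hd h
  · exact count_le_count_succ_of_le_ten hd h
  · exact count_le_count_succ_of_even_le hev h

/-- **`cₘ ≤ cₙ` for `m ≤ n ≤ max (6d, 12) - 1`** (`d ≥ 1`): the one-step inequalities chained along the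
initial segment. (`d = 2`: `n ≤ 11`; `d = 3`: `n ≤ 17`; `d = 4`: `n ≤ 23`.) [cite: BDGS2012, §1.3] -/
theorem count_mono_of_le (hd : 1 ≤ d) {m n : ℕ} (hmn : m ≤ n) (hn : n + 1 ≤ max (6 * d) 12) :
    count d m ≤ count d n := by
  induction n with
  | zero =>
    obtain rfl : m = 0 := by omega
    exact le_rfl
  | succ n ih =>
    rcases Nat.lt_or_ge m (n + 1) with hlt | hge
    · refine (ih (by omega) (by omega)).trans (count_le_count_succ_of_range hd ?_)
      rcases le_max_iff.1 hn with h | h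
      · exact Or.inl (by omega)
      · exact Or.inr (Or.inl (by omega))
    · obtain rfl : m = n + 1 := by omega
      exact le_rfl

/-- `n ↦ cₙ` is monotone on the initial segment `{n | n + 1 ≤ max (6d, 12)}` (`d ≥ 1`). [cite: BDGS2012, §1.3] -/
theorem monotoneOn_count (hd : 1 ≤ d) : MonotoneOn (count d) {n : ℕ | n + 1 ≤ max (6 * d) 12} :=
  fun _ _ _ hn hmn => count_mono_of_le hd hmn hn

/-- At an even length beyond the segment: `cₘ ≤ cₙ₊₁` for `m ≤ n`, `n` even with `n + 6 ≤ 8d`, when the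
segment up to `n` is covered (`n + 1 ≤ max (6d, 12)`). [cite: BDGS2012, §1.3] -/
theorem count_le_count_succ_of_le_of_even (hd : 1 ≤ d) {m n : ℕ} (hmn : m ≤ n) (hev : Even n)
    (hn : n + 6 ≤ 8 * d) (hseg : n + 1 ≤ max (6 * d) 12) : count d m ≤ count d (n + 1) :=
  (count_mono_of_le hd hmn hseg).trans (count_le_count_succ_of_even_le hev hn)

end Literature.Probability.RandomPlanarGeometry.SAW.Zd
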